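/-
Copyright (c) 2026 the pub-hodgecm-mathlib formalisation cell (harness21).  Prover seat hodgecm-mathlib-LH7-p10 (g2), req620 Track A «(D-RAM) FOUR-FRAME» squad
((β₂) road (R-36), β₂-BOARD row (L-Σ), brick (L-Σ-3C): two generic «near 1» estimates feeding the lane-C hinge `hbeta2CellsCFrame_of_cones`), 2026-09-04.
-/
import Literature.NumberTheory.Automorphic.UnitaryThreeFourFrameDefs      -- ★ (B-p04): brings the valued-field ∕ `Matrix` ∕ `WithZero.exp` vocabulary of the (D-RAM) road
import HarnessLib

/-!
# Crux `H413`, line LH4 «(D-RAM) FOUR-FRAME» — (β₂) road, β₂-BOARD row (L-Σ), brick (L-Σ-3C) part 0: «ENTRYWISE `g ≡ 1 (mod ϖ^K)` ON A `2 × 2` BLOCK»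
# — the two «deep near 1» letters `|tr g − 2|`, `|χ_g(1)|`, and the lane-C (RamM, `|jE a| = |a|²`) eigenvalue ∕ depth fence `|λ − 1| ≤ |ϖ^K|²`, `2K ≤ m`

Cell `hodgecm-mathlib` (D-0151), FLOOR 0, crux item H413 = `stmt-HodgeConjecture-24833`, route of record `HCCMUnconditional`; squads F0∕P3c∕LH4 + LH7; lane
`--supports stmt-HodgeConjecture-24833 --as helper` (count-neutral; pays NO tier-0 row).  THEOREMS ONLY (no `def`, no instance, no notation, no `sorry`, default heartbeats).
PURE VALUED-FIELD ALGEBRA over an abstract pair `jE : E →+* M` of `ℤᵐ⁰`-valued fields — no CM token, no lattice.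

WHY.  The CM → GENERIC hinges of the (β₂) lanes (β₂ sub-dealer LH4-p04 (g9) `hbeta2CellsBNear_of_cones` for RamK, this seat's `hbeta2CellsCFrame_of_cones` for RamM)
shrink the neighbourhood `V ∋ 1` so that the `U(Φ₂)`-block `g = g_w` of `γ_H` and the corner `u₀₀` are `≡ 1 (mod ϖ^K)` entrywise (★ `exists_nhds_one_block_congr`) and
must then DERIVE, for the generic letters they feed (★ p862391's `hs hp`, the depth fence `N ≤ m`, `|λ − 1| ≤ |jE ϖ^N|`):
* §1 `trace_det_near_of_congr`: `|tr g − 2| ≤ |ϖ^K|` and `|det g − tr g + 1| ≤ |ϖ^K|·|ϖ^K|` (`tr g − 2 = (g₀₀ − 1) + (g₁₁ − 1)`, `χ_g(1) = (g₀₀ − 1)(g₁₁ − 1) − g₀₁g₁₀`);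
* §2 `v_sub_one_le_of_congr`: in lane C (`|jE a| = |a|²`), the eigenvalue `λ ∈ M` (`λ² = jE(tr g)·λ − jE(det g)`) has `|λ − 1| ≤ |ϖ^K|²` — with `x := λ − 1`,
  `x² = (jE tr g − 2)·x − jE χ_g(1)` and `|jE tr g − 2| ≤ |ϖ^K|²`, `|jE χ_g(1)| ≤ |ϖ^K|⁴`, so `|x| > |ϖ^K|²` would make `|x²|` exceed both summands (integrality of roots);
* §3 `two_mul_le_depth_of_congr`: with the corner `|u₀ − 1| ≤ |ϖ^K|` and `|λ − jE u₀| = exp(−m)`, `2K ≤ m`.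
HONEST LABEL.  Count-neutral valuation bookkeeping; nothing printed is asserted; no census law is stated; `HC_CM` is proved only modulo the 7 printed citations (2 remaining
named inputs: hLiu418 = `stmt-HodgeConjecture-24832`, h413 = `stmt-HodgeConjecture-24833`) until rung 0 closes.
## References
* [Rogawski1990] J. D. Rogawski, *Automorphic Representations of Unitary Groups in Three Variables*, Ann. of Math. Stud. 123 (1990), §4.8 Case (a) p. 53; §4.9 p. 54.
* [BernsteinZelevinsky1976] I. N. Bernstein, A. V. Zelevinsky, *Representations of the group GL(n, F) where F is a non-archimedean local field*, Russian Math. Surveys 31 (1976), §1.1.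
* [CasselsFrohlichANT1967] J. W. S. Cassels, A. Fröhlich (eds.), *Algebraic Number Theory* (1967), Ch. II §10 (integrality of roots of monic integral polynomials).
-/

set_option autoImplicit false

namespace Summit.HodgeConjecture.HodgeConjecture.Cruxes.H413.F0P3cDyRamBlockCongruenceDepthRamM

open scoped Matrix Valued WithZero

variable {E M : Type*} [Field E] [Valued E ℤᵐ⁰] [Field M] [Valued M ℤᵐ⁰]

/-! ## §1 The two «deep near 1» letters -/

/-- **ENTRYWISE `g ≡ 1 (mod ϖ^K)` ⇒ `|tr g − 2| ≤ |ϖ^K|` AND `|det g − tr g + 1| ≤ |ϖ^K|·|ϖ^K|`** (`tr g − 2 = (g₀₀ − 1) + (g₁₁ − 1)`,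
`det g − tr g + 1 = (g₀₀ − 1)(g₁₁ − 1) − g₀₁g₁₀`; ultrametric inequality). [cite: Rogawski1990, §4.8 Case (a) p. 53] [cite: BernsteinZelevinsky1976, §1.1] -/
theorem trace_det_near_of_congr {ϖ : E} {g : Matrix (Fin 2) (Fin 2) E} {K : ℕ}
    (hg : ∀ i j, Valued.v (g i j - (1 : Matrix (Fin 2) (Fin 2) E) i j) ≤ Valued.v (ϖ ^ K)) :
    Valued.v (g.trace - 2) ≤ Valued.v (ϖ ^ K) ∧ Valued.v (g.det - g.trace + 1) ≤ Valued.v (ϖ ^ K) * Valued.v (ϖ ^ K) := by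
  have h00 := hg 0 0; have h11 := hg 1 1; have h01 := hg 0 1; have h10 := hg 1 0
  simp only [Matrix.one_apply_eq, Matrix.one_apply_ne (show (0 : Fin 2) ≠ 1 by decide), Matrix.one_apply_ne (show (1 : Fin 2) ≠ 0 by decide), sub_zero] at h00 h11 h01 h10
  refine ⟨?_, ?_⟩
  · rw [Matrix.trace_fin_two, show g 0 0 + g 1 1 - 2 = (g 0 0 - 1) + (g 1 1 - 1) by ring]
    exact (Valuation.map_add _ _ _).trans (max_le h00 h11)
  · rw [Matrix.det_fin_two, Matrix.trace_fin_two, show g 0 0 * g 1 1 - g 0 1 * g 1 0 - (g 0 0 + g 1 1) + 1 = (g 0 0 - 1) * (g 1 1 - 1) - g 0 1 * g 1 0 by ring]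
    refine (Valuation.map_sub _ _ _).trans (max_le ?_ ?_)
    · rw [Valuation.map_mul]; exact mul_le_mul' h00 h11
    · rw [Valuation.map_mul]; exact mul_le_mul' h01 h10

/-! ## §2 The lane-C eigenvalue estimate -/

/-- **THE LANE-C EIGENVALUE ESTIMATE.**  If `|jE a| = |a|²` (the RamM place: `E′_{w₁} ∕ L_w` ramified), `λ² = jE(tr g)·λ − jE(det g)` and the block `g ≡ 1 (mod ϖ^K)`,
then `|λ − 1| ≤ |ϖ^K|²`: with `x := λ − 1`, `x² = (jE tr g − 2)·x − jE(χ_g(1))`, `|jE tr g − 2| ≤ |ϖ^K|²`, `|jE χ_g(1)| ≤ |ϖ^K|⁴`, so `|x| > |ϖ^K|²` would make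
`|x²|` exceed both summands. [cite: CasselsFrohlichANT1967, Ch. II §10] [cite: Rogawski1990, §4.9 p. 54] -/
theorem v_sub_one_le_of_congr (jE : E →+* M) (hjE : ∀ a, Valued.v (jE a) = Valued.v a ^ 2) {ϖ : E} {g : Matrix (Fin 2) (Fin 2) E} {lam : M}
    (hlam2 : lam * lam = jE g.trace * lam - jE g.det) {K : ℕ} (hg : ∀ i j, Valued.v (g i j - (1 : Matrix (Fin 2) (Fin 2) E) i j) ≤ Valued.v (ϖ ^ K)) :
    Valued.v (lam - 1) ≤ Valued.v (ϖ ^ K) * Valued.v (ϖ ^ K) := by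
  obtain ⟨htr, hχ⟩ := trace_det_near_of_congr hg
  have ha : Valued.v (jE g.trace - 2) ≤ Valued.v (ϖ ^ K) * Valued.v (ϖ ^ K) := by
    rw [show jE g.trace - 2 = jE (g.trace - 2) by rw [map_sub, map_ofNat], hjE, pow_two]; exact mul_le_mul' htr htr
  have hb : Valued.v (jE (g.det - g.trace + 1)) ≤ (Valued.v (ϖ ^ K) * Valued.v (ϖ ^ K)) * (Valued.v (ϖ ^ K) * Valued.v (ϖ ^ K)) := by
    rw [hjE, pow_two]; exact mul_le_mul' hχ hχ
  have hx : (lam - 1) * (lam - 1) = (jE g.trace - 2) * (lam - 1) + -(jE (g.det - g.trace + 1)) := by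
    rw [map_add, map_sub, map_one]; linear_combination hlam2
  by_contra hlt; rw [not_le] at hlt
  have hx0 : 0 < Valued.v (lam - 1) := lt_of_le_of_lt zero_le hlt
  have h1 : Valued.v ((jE g.trace - 2) * (lam - 1)) < Valued.v (lam - 1) * Valued.v (lam - 1) := by
    rw [Valuation.map_mul]; exact mul_lt_mul_of_pos_right (ha.trans_lt hlt) hx0
  have h2 : Valued.v (-(jE (g.det - g.trace + 1))) < Valued.v (lam - 1) * Valued.v (lam - 1) := by
    rw [Valuation.map_neg]; refine hb.trans_lt ?_
    calc (Valued.v (ϖ ^ K) * Valued.v (ϖ ^ K)) * (Valued.v (ϖ ^ K) * Valued.v (ϖ ^ K))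
        ≤ (Valued.v (ϖ ^ K) * Valued.v (ϖ ^ K)) * Valued.v (lam - 1) := mul_le_mul_right hlt.le _
      _ < Valued.v (lam - 1) * Valued.v (lam - 1) := mul_lt_mul_of_pos_right hlt hx0
  have h3 : Valued.v ((lam - 1) * (lam - 1)) < Valued.v (lam - 1) * Valued.v (lam - 1) := by
    rw [hx]; exact (Valuation.map_add _ _ _).trans_lt (max_lt h1 h2)
  rw [Valuation.map_mul] at h3; exact lt_irrefl _ h3

/-! ## §3 The lane-C depth fence -/

/-- **THE LANE-C DEPTH FENCE**: under `v_sub_one_le_of_congr`'s hypotheses plus the corner `u₀ ≡ 1 (mod ϖ^K)`, `|ϖ| = exp(−1)` and `|λ − jE u₀| = exp(−m)`: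
`2K ≤ m` (`|λ − jE u₀| ≤ max(|λ − 1|, |jE(u₀ − 1)|) ≤ |ϖ^K|² = exp(−2K)`). [cite: CasselsFrohlichANT1967, Ch. II §10] [cite: Rogawski1990, §4.9 p. 54] -/
theorem two_mul_le_depth_of_congr (jE : E →+* M) (hjE : ∀ a, Valued.v (jE a) = Valued.v a ^ 2)
    {ϖ : E} (hϖ : Valued.v ϖ = WithZero.exp (-1 : ℤ)) {g : Matrix (Fin 2) (Fin 2) E} {lam : M}
    (hlam2 : lam * lam = jE g.trace * lam - jE g.det) {u₀ : E} {K m : ℕ}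
    (hg : ∀ i j, Valued.v (g i j - (1 : Matrix (Fin 2) (Fin 2) E) i j) ≤ Valued.v (ϖ ^ K))
    (hu : Valued.v (u₀ - 1) ≤ Valued.v (ϖ ^ K)) (hm : Valued.v (lam - jE u₀) = WithZero.exp (-(m : ℤ))) : 2 * K ≤ m := by
  have hμ : Valued.v (lam - jE u₀) ≤ Valued.v (ϖ ^ K) * Valued.v (ϖ ^ K) := by
    rw [show lam - jE u₀ = (lam - 1) - jE (u₀ - 1) by rw [map_sub, map_one]; ring]
    refine (Valuation.map_sub _ _ _).trans (max_le (v_sub_one_le_of_congr jE hjE hlam2 hg) ?_)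
    rw [hjE, pow_two]; exact mul_le_mul' hu hu
  have hK : Valued.v (ϖ ^ K) = WithZero.exp (-(K : ℤ)) := by
    rw [map_pow, hϖ, ← WithZero.exp_nsmul]; congr 1; simp
  rw [hm, hK, ← WithZero.exp_add, WithZero.exp_le_exp] at hμ; omega


end Summit.HodgeConjecture.HodgeConjecture.Cruxes.H413.F0P3cDyRamBlockCongruenceDepthRamM
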